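/-
Origin: expansion seat `planner-pub-hodgecm-toy-g2-0`, handover #34 2026-08-18T10:24:56Z (`HOME/pub-hodgecm-toy-g2/lean/ToyG2/HodgeRieszSplit.lean`, md5 22134fb3, 208 lines);
landed by the gen-7 packager in gate run 28 as `HodgeCM/Model/ToyG2/HodgeRieszSplit.lean` (verbatim).
-/
/-
# HodgeCM.Model.ToyG2.HodgeRieszSplit — `HodgeRiesz` from a weight-stable rational complement of the right radical (G3, step S3)

Generation 2 of the `pub-hodgecm-toy` lineage (seat `planner-pub-hodgecm-toy-g2-0`), DESIGN.md §9·UPDATE 10:25Z step (S3).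
The last open statement of the G4 programme is Hodge–Riesz for good objects containing blocks, where the trace pairing
`⋀⁴ H¹X × ⋀^j H¹X → ℚ` (`j = 2 (dim X − 2)`) is degenerate.  This file proves the STRUCTURAL REDUCTION:

**`hodgeRiesz_of_rightSplit`**: if the right radical `trRightRad X 4 j` has a rational complement `W` whose complexification `WC X j W`
is stable under the weight operators `wt z j`, then `HodgeRiesz X`.

Proof: a representative of the functional can be chosen in `W` (`exists_repr_of_forall_leftRad` + the decomposition
`⋀^j = trRightRad ⊕ W`); the argument of `hodgeRiesz_of_isBlockFree` (types of `lam` and of `tr_X`) shows that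
`D = wt₂ c_ℂ − 2^{dim−2} c_ℂ` pairs to zero with everything; `D ∈ WC` by stability; and **`eq_zero_of_mem_WC`**: an element of `WC`
pairing to zero with all rational classes vanishes — by the dual vectors `y_l` (`tr(y_l ∧ w_m) = δ_{lm}` for a basis `w_m` of `W`), which
exist by `exists_eq_flip_of_ker_le` (TensorRadical) because `trRightRad ∩ W = 0`.  Hence `wt₂ c_ℂ = 2^{dim−2} c_ℂ` and `c` is a Hodge class.
So G3 for all good objects (and with it `ModelAxioms`, by `toyUniverse₃_modelAxioms_of_hodgeRiesz` of `RadicalProdStep`) follows from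
the existence of such complements (`RightSplit`), a statement about the toy Hodge structures alone (DESIGN.md §9·UPDATE 10:25Z S1–S2).
-/
import Mathlib
import Summits.HodgeConjecture.HodgeCM.Model.ToyG2.HodgeRieszFree
import Summits.HodgeConjecture.HodgeCM.Model.ToyG2.TensorRadical
import Summits.HodgeConjecture.HodgeCM.Model.ToyG2.Bidegree

namespace HodgeCM.ToyG2

open HodgeCM.Toy HodgeCM.Toy.CMPresentation
open Literature.AlgebraicGeometry.Motives
open scoped TensorProduct
open exteriorPower Obj₂

noncomputable section

/-! ### the right radical and weight-stable complements -/

/-- right radical of the trace pairing `⋀ⁱ × ⋀ʲ → ℚ` -/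
def trRightRad (X : Obj₂) (i j : ℕ) : Submodule ℚ (⋀[ℚ]^j X.L) := LinearMap.ker (trPairing X i j).flip

/-- (Ported verbatim from the HodgeCMPerL package; no docstring in the source.) -/
theorem mem_trRightRad {X : Obj₂} {i j : ℕ} {c : ⋀[ℚ]^j X.L} :
    c ∈ trRightRad X i j ↔ ∀ y, trOf X (i + j) (wedge ℚ X.L i j y c) = 0 := by
  rw [trRightRad, LinearMap.mem_ker, LinearMap.ext_iff]
  exact Iff.rfl

/-- the complexification of a rational subspace `W ⊂ ⋀ʲ H¹X` inside `⋀ʲ_ℂ` -/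
def WC (X : Obj₂) (j : ℕ) (W : Submodule ℚ (⋀[ℚ]^j X.L)) : Submodule ℂ (⋀[ℂ]^j X.toObj.LC) :=
  Submodule.span ℂ (Set.range fun w : W => X.toObj.Θ j ((1 : ℂ) ⊗ₜ[ℚ] (w : ⋀[ℚ]^j X.L)))

/-- `W` is a rational complement of the right radical of `⋀⁴ × ⋀ʲ → ℚ` whose complexification is stable under the weight operators -/
def RightSplit (X : Obj₂) (j : ℕ) (W : Submodule ℚ (⋀[ℚ]^j X.L)) : Prop :=
  IsCompl (trRightRad X 4 j) W ∧ ∀ z : ℂ, ∀ v ∈ WC X j W, X.toObj.wt z j v ∈ WC X j W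

/-- (Ported verbatim from the HodgeCMPerL package; no docstring in the source.) -/
lemma theta_one_tmul_smul (A : Obj) (k : ℕ) (q : ℚ) (x : ⋀[ℚ]^k A.L) :
    A.Θ k ((1 : ℂ) ⊗ₜ[ℚ] (q • x)) = (q : ℂ) • A.Θ k ((1 : ℂ) ⊗ₜ[ℚ] x) := by
  rw [← map_smul, TensorProduct.smul_tmul', smul_eq_mul, mul_one, ← TensorProduct.smul_tmul, Rat.smul_one_eq_cast]

set_option maxHeartbeats 1600000 in
/-- **an element of `WC` pairing to zero with all rational classes of complementary degree vanishes** (`trRightRad ∩ W = 0`) -/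
theorem eq_zero_of_mem_WC {X : Obj₂} {j : ℕ} {W : Submodule ℚ (⋀[ℚ]^j X.L)} (hdis : Disjoint (trRightRad X 4 j) W)
    {v : ⋀[ℂ]^j X.toObj.LC} (hv : v ∈ WC X j W)
    (h0 : ∀ y : ⋀[ℚ]^4 X.L, baseC X.toObj (trOf X (4 + j))
      (wedge ℂ X.toObj.LC 4 j (X.toObj.Θ 4 ((1 : ℂ) ⊗ₜ[ℚ] y)) v) = 0) : v = 0 := by
  haveI : Module.Free ℚ (↥(⋀[ℚ]^4 X.L)) := Module.Free.of_divisionRing ℚ _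
  haveI : Module.Finite ℚ (↥(⋀[ℚ]^4 X.L)) := exteriorPower.instFinite
  haveI : Module.Free ℚ (↥(⋀[ℚ]^j X.L)) := Module.Free.of_divisionRing ℚ _
  haveI : Module.Finite ℚ (↥(⋀[ℚ]^j X.L)) := exteriorPower.instFinite
  haveI : Module.Free ℚ (↥W) := Module.Free.of_divisionRing ℚ (↥W)
  haveI : Module.Finite ℚ W := Module.Finite.of_injective W.subtype W.injective_subtype
  let bW := Module.finBasis ℚ W
  -- (a) `v` is a ℂ-combination of the complexified basis vectors of `W`
  have hv' : v ∈ Submodule.span ℂ (Set.range fun m => X.toObj.Θ j ((1 : ℂ) ⊗ₜ[ℚ] ((bW m : W) : ⋀[ℚ]^j X.L))) := by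
    refine (Submodule.span_le.2 ?_) hv
    rintro _ ⟨w, rfl⟩
    show X.toObj.Θ j ((1 : ℂ) ⊗ₜ[ℚ] (W.subtype w))
      ∈ Submodule.span ℂ (Set.range fun m => X.toObj.Θ j ((1 : ℂ) ⊗ₜ[ℚ] ((bW m : W) : ⋀[ℚ]^j X.L)))
    rw [← bW.sum_repr w, map_sum, TensorProduct.tmul_sum, map_sum]
    refine Submodule.sum_mem _ fun m _ => ?_
    rw [map_smul, Submodule.subtype_apply, theta_one_tmul_smul]
    exact Submodule.smul_mem _ _ (Submodule.subset_span ⟨m, rfl⟩)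
  obtain ⟨μ, hμ⟩ := (Submodule.mem_span_range_iff_exists_fun ℂ).1 hv'
  -- (b) dual vectors: `tr(y_l ∧ w) = (l-th coordinate of w)` — they exist because `trRightRad ∩ W = 0`
  have hdual : ∀ l, ∃ y : ⋀[ℚ]^4 X.L, ∀ w : W, trOf X (4 + j) (wedge ℚ X.L 4 j y w) = bW.coord l w := by
    intro l
    obtain ⟨B₁, hB₁⟩ : ∃ B₁ : ↥W →ₗ[ℚ] ↥(⋀[ℚ]^4 X.L) →ₗ[ℚ] ℚ, B₁ = (trPairing X 4 j).flip ∘ₗ W.subtype :=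
      ⟨_, rfl⟩
    have hker : ∀ r ∈ LinearMap.ker B₁, (bW.coord l) r = 0 := by
      intro r hr
      have hrR : (r : ⋀[ℚ]^j X.L) ∈ trRightRad X 4 j := by
        refine mem_trRightRad.2 fun y => ?_
        have h1 := LinearMap.congr_fun (LinearMap.mem_ker.1 hr) y
        rw [hB₁, LinearMap.comp_apply, LinearMap.flip_apply, LinearMap.zero_apply] at h1
        exact h1
      have h0 : (r : ⋀[ℚ]^j X.L) = 0 := by
        have h1 : (r : ⋀[ℚ]^j X.L) ∈ trRightRad X 4 j ⊓ W := Submodule.mem_inf.2 ⟨hrR, r.2⟩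
        rw [hdis.eq_bot, Submodule.mem_bot] at h1
        exact h1
      have h0' : r = 0 := Subtype.ext h0
      rw [h0', map_zero]
    obtain ⟨y, hy⟩ := exists_eq_flip_of_ker_le (K := ℚ) (U₁ := ↥W) (W₁ := ↥(⋀[ℚ]^4 X.L)) B₁ (bW.coord l) hker
    exact ⟨y, fun w => by rw [← LinearMap.congr_fun hy w, hB₁]; rfl⟩
  choose yv hyv using hdual
  -- (c) evaluate `h0` at the dual vectors
  have hμ0 : ∀ l, μ l = 0 := by
    intro l
    have h := h0 (yv l)
    rw [← hμ, map_sum, map_sum] at h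
    simp only [map_smul, wedge_theta_one_tmul, baseC_theta_one_tmul, hyv, smul_eq_mul] at h
    rw [Finset.sum_eq_single l (fun m _ hml => by
        rw [Module.Basis.coord_apply, bW.repr_self, Finsupp.single_apply, if_neg hml, Rat.cast_zero, mul_zero])
      (fun h' => absurd (Finset.mem_univ l) h')] at h
    rw [Module.Basis.coord_apply, bW.repr_self, Finsupp.single_apply, if_pos rfl, Rat.cast_one, mul_one] at h
    exact h
  rw [← hμ]
  exact Finset.sum_eq_zero fun m _ => by rw [hμ0 m, zero_smul]

/-! ### Hodge–Riesz from a split -/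

set_option maxHeartbeats 1600000 in
/-- **G3, structural form**: a weight-stable rational complement of the right radical gives `HodgeRiesz X` -/
theorem hodgeRiesz_of_rightSplit {X : Obj₂} (hX : X.Good) (W : Submodule ℚ (⋀[ℚ]^(2 * (X.dim - 2)) X.L))
    (hW : RightSplit X (2 * (X.dim - 2)) W) : HodgeRiesz X := by
  intro lam hlam hrad
  by_cases h2 : 2 ≤ X.dim
  swap
  · have hbf : X.IsBlockFree := fun u hu => by
      have h4 := four_le_sdeg_of_isPB X.s X.leaf u hu
      rw [sdeg_eq] at h4
      omega
    exact hodgeRiesz_of_isBlockFree hbf lam hlam hrad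
  -- Step 1: a representative in `W`
  obtain ⟨c₀, hc₀⟩ := exists_repr_of_forall_leftRad lam hrad
  have hmem : c₀ ∈ trRightRad X 4 (2 * (X.dim - 2)) ⊔ W := by
    rw [hW.1.sup_eq_top]
    trivial
  obtain ⟨r, hr, c, hcW, hrc⟩ := Submodule.mem_sup.1 hmem
  have hrep : ∀ y, lam y = trOf X (4 + 2 * (X.dim - 2)) (wedge ℚ X.L 4 (2 * (X.dim - 2)) y c) := by
    intro y
    rw [hc₀ y, ← hrc, map_add, map_add, (mem_trRightRad.1 hr) y, zero_add]
  refine ⟨c, ?_, hrep⟩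
  -- Step 2: the representative is a Hodge class
  -- (I) the complexified identity
  have hI : ∀ Y : ⋀[ℂ]^4 X.toObj.LC, baseC X.toObj lam Y
      = baseC X.toObj (trOf X (4 + 2 * (X.dim - 2)))
          (wedge ℂ X.toObj.LC 4 (2 * (X.dim - 2)) Y
            (X.toObj.Θ (2 * (X.dim - 2)) ((1 : ℂ) ⊗ₜ[ℚ] c))) := by
    suffices h : baseC X.toObj lam = baseC X.toObj (trOf X (4 + 2 * (X.dim - 2))) ∘ₗ
        (wedge ℂ X.toObj.LC 4 (2 * (X.dim - 2))).flip (X.toObj.Θ (2 * (X.dim - 2)) ((1 : ℂ) ⊗ₜ[ℚ] c)) by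
      intro Y
      rw [h]
      rfl
    haveI : Module.Free ℚ X.L := Module.Free.of_divisionRing ℚ _
    let bQ := Module.finBasis ℚ X.L
    refine exteriorPower.linearMap_ext ?_
    refine Module.Basis.ext_alternating (Algebra.TensorProduct.basis ℂ bQ) fun g _ => ?_
    simp only [LinearMap.compAlternatingMap_apply, LinearMap.coe_comp, Function.comp_apply,
      LinearMap.flip_apply, Algebra.TensorProduct.basis_apply]
    exact (baseCA_tmul X.toObj lam (fun i => bQ (g i))).trans
      (((congrArg (fun q : ℚ => (q : ℂ)) (hrep _))).trans
        (baseC_wedge_ιMulti_theta X.toObj _ (fun i => bQ (g i)) c).symm)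
  -- types
  have htr := trType_of_good hX
  have h1 : ∀ W, baseC X.toObj (trOf X (4 + 2 * (X.dim - 2))) (X.toObj.wt 2 (4 + 2 * (X.dim - 2)) W)
      = (2 : ℂ) ^ X.dim * baseC X.toObj (trOf X (4 + 2 * (X.dim - 2))) W := fun W => by
    have h := LinearMap.congr_fun (htr (4 + 2 * (X.dim - 2)) 2) W
    rw [LinearMap.comp_apply, LinearMap.smul_apply, smul_eq_mul] at h
    exact h
  have hl : ∀ W, baseC X.toObj lam (X.toObj.wt 2 4 W) = (2 : ℂ) ^ 2 * baseC X.toObj lam W := fun W => by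
    have h := LinearMap.congr_fun (hlam 2) W
    rw [LinearMap.comp_apply, LinearMap.smul_apply, smul_eq_mul] at h
    exact h
  have hY : ∀ Y : ⋀[ℂ]^4 X.toObj.LC, X.toObj.wt 2 4 (X.toObj.wt 2⁻¹ 4 Y) = Y := fun Y => by
    rw [← LinearMap.comp_apply, Obj.wt_mul, mul_inv_cancel₀ two_ne_zero, Obj.wt_one,
      LinearMap.id_apply]
  -- the key identity: tr_ℂ (Y ∧ wt₂ C) = 2^{dim-2} tr_ℂ (Y ∧ C)
  have hkey : ∀ Y : ⋀[ℂ]^4 X.toObj.LC,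
      baseC X.toObj (trOf X (4 + 2 * (X.dim - 2)))
          (wedge ℂ X.toObj.LC 4 (2 * (X.dim - 2)) Y
            (X.toObj.wt 2 (2 * (X.dim - 2)) (X.toObj.Θ (2 * (X.dim - 2)) ((1 : ℂ) ⊗ₜ[ℚ] c))))
        = (2 : ℂ) ^ (X.dim - 2) * baseC X.toObj (trOf X (4 + 2 * (X.dim - 2)))
          (wedge ℂ X.toObj.LC 4 (2 * (X.dim - 2)) Y
            (X.toObj.Θ (2 * (X.dim - 2)) ((1 : ℂ) ⊗ₜ[ℚ] c))) := by
    intro Y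
    have hpow : (2 : ℂ) ^ X.dim = (2 : ℂ) ^ (X.dim - 2) * (2 : ℂ) ^ 2 := by
      rw [← pow_add, Nat.sub_add_cancel h2]
    conv_lhs => rw [← hY Y, ← Obj.wt_wedge, h1, ← hI, hpow, mul_assoc, ← hl, hY Y, hI]
  -- the defect `D = wt₂ C − 2^{dim−2} C` pairs to zero with every rational class and lies in `WC`
  have hD0 : ∀ y : ⋀[ℚ]^4 X.L, baseC X.toObj (trOf X (4 + 2 * (X.dim - 2)))
      (wedge ℂ X.toObj.LC 4 (2 * (X.dim - 2)) (X.toObj.Θ 4 ((1 : ℂ) ⊗ₜ[ℚ] y))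
        (X.toObj.wt 2 (2 * (X.dim - 2)) (X.toObj.Θ (2 * (X.dim - 2)) ((1 : ℂ) ⊗ₜ[ℚ] c))
          - (2 : ℂ) ^ (X.dim - 2) • X.toObj.Θ (2 * (X.dim - 2)) ((1 : ℂ) ⊗ₜ[ℚ] c))) = 0 := fun y => by
    rw [map_sub, map_smul, map_sub, map_smul, hkey, smul_eq_mul, sub_self]
  have hCW : X.toObj.Θ (2 * (X.dim - 2)) ((1 : ℂ) ⊗ₜ[ℚ] c) ∈ WC X (2 * (X.dim - 2)) W :=
    Submodule.subset_span ⟨⟨c, hcW⟩, rfl⟩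
  have hDW : X.toObj.wt 2 (2 * (X.dim - 2)) (X.toObj.Θ (2 * (X.dim - 2)) ((1 : ℂ) ⊗ₜ[ℚ] c))
      - (2 : ℂ) ^ (X.dim - 2) • X.toObj.Θ (2 * (X.dim - 2)) ((1 : ℂ) ⊗ₜ[ℚ] c) ∈ WC X (2 * (X.dim - 2)) W :=
    Submodule.sub_mem _ (hW.2 2 _ hCW) (Submodule.smul_mem _ _ hCW)
  have hD := eq_zero_of_mem_WC hW.1.disjoint hDW hD0
  have hwt := sub_eq_zero.1 hD
  have hof : (HodgeStructure.ofRat c : ℂ ⊗[ℚ] ↥(⋀[ℚ]^(2 * (X.dim - 2)) X.L)) = (1 : ℂ) ⊗ₜ[ℚ] c := rfl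
  exact X.toObj.mem_hodgeClasses_of_wt_two (m := X.dim - 2) (v := c) (by rw [hof]; exact hwt)

/-- hence: weight-stable complements for every good object give Hodge–Riesz for every good object -/
theorem hodgeRiesz_of_splits (h : ∀ X : Obj₂, X.Good → ∃ W, RightSplit X (2 * (X.dim - 2)) W) :
    ∀ X : Obj₂, X.Good → HodgeRiesz X := fun X hX => by
  obtain ⟨W, hW⟩ := h X hX
  exact hodgeRiesz_of_rightSplit hX W hW

end

end HodgeCM.ToyG2
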